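/-
Copyright (c) 2026 the pub-hodgecm-mathlib formalisation cell (harness21).  Prover seat hodgecm-mathlib-K2E1-p10 (g3) (E1 hand lent to L4 per K2-lead R40 (2)), Track B ∕ K2-LIT,
h413 = `stmt-HodgeConjecture-24833`, route of record `HCCMUnconditional`, line `K2_E3_EllipticInputs` (L4, `stub_StCharTS` on the `N ≤ 3` cut), deal D139 of LINE-LEAD K2E3-plan (g4)
(2026-09-04T14:55:09Z): the `N = 2` twin of Literature ★ `UnitarySingularLocusNull` ∕ ★ `CubicDiscriminantDiagonalScaling` ∕ ★ [M2a] `K2E3SupercuspModelFrameAtPlace` §5 —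
«the singular set of a unitary group in TWO variables over a local field is Haar-null», consumed by K2E3-p31 (g0)'s `K2E3SupercuspModelFrameAtPlaceTwo` §5.
-/
import Summits.HodgeConjecture.HodgeConjecture.Theorems.F0P3cStCharTSSingularNullH        -- ★ (H2): `det_quasiSplitFrameTwo`, `formCongr_quasiSplitFrameTwo_eq_diagonal` (the frame `ᵗT Φ₂ T = diag(2,−2)`); brings Literature ★ `EndoscopicSingularLocusNull` (generic diagonal torus), ★ `UnitarySingularLocusNull` (§1 parameter torus), ★ `MvPolynomialZeroSetNull`, ★ `UnitaryCartanRegularAE`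
import Summits.HodgeConjecture.HodgeConjecture.Theorems.F0P3cCMLocalNonsplitBorelTransportU2  -- ★ `placeForm_antidiagTwo_eq` (`(Φ₂)_w = (StdForm.antidiagonal 2).over L_w`)
import Mathlib.LinearAlgebra.Matrix.Charpoly.Coeff                                          -- Mathlib `Matrix.charpoly_fin_two`
import HarnessLib

/-!
# h413 ∕ Track B «K2-LIT», line `K2_E3_EllipticInputs` (L4), D139 — `K2E3UnitarySingularLocusNullTwo`: THE SINGULAR SET OF A UNITARY GROUP IN TWO VARIABLES OVER A LOCAL FIELD IS
# HAAR-NULL (model level, any form congruent to a diagonal one), the rational frame `ᵗT Φ₂ T = diag(2, −2)`, and the place-level print on `U(σ_w, Φ₂)(L_w)` for the CM pair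

Cell `pub/hodgecm-mathlib`, crux h413 = `stmt-HodgeConjecture-24833`, route `HCCMUnconditional`; L4 LINE-LEAD K2E3-plan (g4) deal D139, consumer K2E3-p31 (g0) (`…FrameAtPlaceTwo` §5);
spec = p31's R0 14:54:37Z §5 (i)–(iii).  THEOREMS ONLY (no `def`, no `instance`, no notation, no named-fact hypothesis, no `sorry`); lane `--supports stmt-HodgeConjecture-24833 --as helper`
(count-neutral).  Closes no socket.  It is the `Fin 3 ↦ Fin 2` twin, token for token, of Literature ★ `UnitarySingularLocusNull` §2–§3 (Harish-Chandra's Lemma 42 for `U(σ, J)(K)`,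
`J ∈ M₃(K)` congruent to a diagonal form) and of ★ `CubicDiscriminantDiagonalScaling` (its rank-`3` algebra), over the SAME rank-free ★ engines: §1's parameter torus
(`exists_atomless_measure_normOneTorus`: an atomless finite measure on `U(1) = {u | u σ(u) = 1}`), the shear criterion (★ `measure_eq_zero_of_forall_shear_null`), zero sets of non-zero
polynomials under products of atomless measures (★ `pi_zeroLocus_mvPolynomial_eq_zero`), and the transport ★ `unitaryGroupOfFormCongrOfEq`.

THE MATHEMATICS.  (i) RANK-`2` ALGEBRA (§1): for `p = X² + bX + c`, `−4·p + p′·p′ = b² − 4c =: Δ` (Bézout), so `Δ ≠ 0 ⇒ p` separable; `charpoly M = X² − tr M·X + det M` (Mathlib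
`Matrix.charpoly_fin_two`), so `D := (X₀₀ + X₁₁)² − 4(X₀₀X₁₁ − X₀₁X₁₀)` is a polynomial in the entries with `D(M) ≠ 0 ⇒ charpoly M` separable; and for EVERY `g` with `det g ≠ 0`,
`t ↦ D(diag(t)·g)` is not identically zero: `D(diag(1, s)·g) = (g₀₀ + s g₁₁)² − 4 s·det g`, and if this vanished at `s = 1, 2, 3` the second finite difference would give `g₁₁ = 0` and the
first `det g = 0`.  (ii) MODEL LEVEL (§2): verbatim ★ §2–§3 — the diagonal torus `diag(u)`, `u ∈ U(1)²`, shears the closed set `S = {D = 0} ⊇ {¬ separable}`; every fibre lies in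
`(U(1)²)ᶜ ∪ {D(diag(u)·g) = 0}`, null for `μ₁ ⊗ μ₁`; general `J` with `ᵗσ(T) J T = diag h` by transport along `g ↦ T g T⁻¹`.  (iii) THE FRAME (§3): `T = [[1,1],[1,−1]]` (rational, so `σ_w`-fixed;
`det T = −2 ≠ 0` in characteristic `0`) gives `ᵗσ_w(T) Φ₂ T = diag(2, −2)` for `Φ₂ = antidiag(1,1) = (StdForm.antidiagonal 2).over L_w`.  PLACE LEVEL (§3): for the CM pair `L ∕ L⁺`, a non-split
`v` (`w ∣ v`, `c • w = w`), the one-place model `U(σ_w, Φ₂)(L_w)` (a characteristic-`0` local field, `σ_w` a continuous involution with a skew element ★ `exists_skew_ne_zero_adicCompletion`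
and a fixed null sequence ★ `exists_null_seq_fixed_adicCompletion`): `μ {g | ¬ IsRegularElt g} = 0` for every Haar `μ` — the `N = 2` twin of ★ [M2a] §5.

* §1 `quadratic_discriminant_bezout`, `separable_quadratic_of_discriminant_ne_zero`, `eq_zero_of_quadratic_vanishes`, **`exists_mvPolynomial_discr_charpoly_fin_two`**.
* §2 `exists_closed_null_superset_singular_diagonal_two`, **`exists_closed_null_superset_singular_two`**,
  **`measure_setOf_not_separable_charpoly_eq_zero_two`**.
* §3 **`measure_setOf_not_isRegularElt_eq_zero_of_eq_over_two`**, **`ae_isRegularElt_of_eq_over_two`** (the frame `ᵗT Φ₂ T = diag(2,−2)` is ★ `F0P3cStCharTSSingularNullH.formCongr_quasiSplitFrameTwo_eq_diagonal`,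
  `(Φ₂)_w = (StdForm.antidiagonal 2).over L_w` is ★ `placeForm_antidiagTwo_eq`; the diagonal torus is ★ `mem_unitaryGroupOfForm_diagonal_of_coe_eq_diagonal`).

HONEST LABEL: HC_CM is proved only modulo the 7 printed citations (2 remaining named inputs: hLiu418 = `stmt-HodgeConjecture-24832`, h413 = `stmt-HodgeConjecture-24833`) until rung 0
closes; this file is a count-neutral helper (place-level plumbing for the `N = 2` supercuspidal slice; nothing printed is asserted as a fact).
References: [HarishChandra1970] Harish-Chandra (van Dijk), *Harmonic Analysis on Reductive p-adic Groups*, LNM 162, Part V Lemma 42; [Rogawski1990] J. D. Rogawski, *Automorphic Representations of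
Unitary Groups in Three Variables*, §12.2 p. 173, §12.5 p. 182; [Lang2002] S. Lang, *Algebra*, IV §8 (discriminant, `Res(p, p′)`); [PlatonovRapinchuk1994] Platonov–Rapinchuk, §2.3 (congruent forms);
[Folland1995] G. B. Folland, *A Course in Abstract Harmonic Analysis*, §2.2, Prop. 2.4.
-/

set_option autoImplicit false
set_option linter.dupNamespace false  -- the mandated namespace repeats the single-problem summit's segment (`HodgeConjecture.HodgeConjecture`)

noncomputable section

open NumberField IsDedekindDomain MeasureTheory Measure Filter Topology Set Function Polynomial
open Literature.NumberTheory.Rogawski1990 Literature.NumberTheory.Automorphic Literature.NumberTheory.Automorphic.UnitaryGroup Literature.MeasureTheory.Constructions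
open Literature.LinearAlgebra.Matrix (exists_atomless_measure_normOneTorus isClosed_unitaryGroupOfForm)
open Summit.HodgeConjecture.HodgeConjecture.Cruxes.H413.F0P3cStCharTSSingularNullH (formCongr_quasiSplitFrameTwo_eq_diagonal)
open Summit.HodgeConjecture.HodgeConjecture.Cruxes.H413.F0P3cCMLocalNonsplitBorelTransportU2 (placeForm_antidiagTwo_eq)
open scoped Matrix MatrixGroups

namespace Summit.HodgeConjecture.HodgeConjecture.Cruxes.H413.K2E3UnitarySingularLocusNullTwo

/-! ## §1 Rank-`2` algebra: the quadratic discriminant; a discriminant polynomial in the entries, non-vanishing along diagonal scalings -/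

section Algebra

/-- **Bézout identity for the quadratic discriminant**: for `p = X² + bX + c`, `−4·p + p′·p′ = b² − 4c` (so the discriminant lies in the ideal `(p, p′)`). [cite: Lang2002, IV §8] -/
theorem quadratic_discriminant_bezout {R : Type*} [CommRing R] (b c : R) :
    C (-4) * (X ^ 2 + C b * X + C c) + derivative (X ^ 2 + C b * X + C c) * derivative (X ^ 2 + C b * X + C c) = C (b ^ 2 - 4 * c) := by
  have hd : derivative (X ^ 2 + C b * X + C c : R[X]) = C 2 * X + C b := by
    simp only [derivative_add, derivative_mul, derivative_X_pow, derivative_C, derivative_X, zero_mul, zero_add, add_zero, mul_one, map_ofNat, Nat.cast_ofNat]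
    ring
  rw [hd]
  simp only [map_sub, map_mul, map_pow, map_neg, map_ofNat]
  ring

/-- **A quadratic with non-zero discriminant is separable** (over a field): `b² − 4c ≠ 0 ⇒ X² + bX + c` is coprime to its derivative (divide the Bézout identity by the discriminant).
[cite: Lang2002, IV §8] -/
theorem separable_quadratic_of_discriminant_ne_zero {K : Type*} [Field K] (b c : K) (h : b ^ 2 - 4 * c ≠ 0) : (X ^ 2 + C b * X + C c : K[X]).Separable := by
  rw [Polynomial.separable_def]
  refine ⟨C (b ^ 2 - 4 * c)⁻¹ * C (-4), C (b ^ 2 - 4 * c)⁻¹ * derivative (X ^ 2 + C b * X + C c), ?_⟩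
  calc C (b ^ 2 - 4 * c)⁻¹ * C (-4) * (X ^ 2 + C b * X + C c) + C (b ^ 2 - 4 * c)⁻¹ * derivative (X ^ 2 + C b * X + C c) * derivative (X ^ 2 + C b * X + C c)
        = C (b ^ 2 - 4 * c)⁻¹ * (C (-4) * (X ^ 2 + C b * X + C c) + derivative (X ^ 2 + C b * X + C c) * derivative (X ^ 2 + C b * X + C c)) := by ring
    _ = 1 := by rw [quadratic_discriminant_bezout, ← map_mul, inv_mul_cancel₀ h, map_one]

/-- Finite-difference extraction: if `(α + sβ)² − 4sm = 0` for `s = 1, 2, 3` then `m = 0` (characteristic `0`; the second difference kills all but `2β²`, the first then gives `4m`).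
[cite: Lang2002, IV §8] -/
theorem eq_zero_of_quadratic_vanishes {K : Type*} [Field K] [CharZero K] (α β m : K) (h : ∀ s : K, s ≠ 0 → (α + s * β) ^ 2 - 4 * s * m = 0) : m = 0 := by
  have h1 := h 1 one_ne_zero
  have h2 := h 2 two_ne_zero
  have h3 := h 3 (by norm_num)
  have hβ : β ^ 2 = 0 := by linear_combination (h1 - 2 * h2 + h3) / 2
  have hβ0 : β = 0 := (pow_eq_zero_iff two_ne_zero).mp hβ
  linear_combination (h1 - h2) / 4 + ((2 * α + 3 * β) / 4) * hβ0

/-- **A DISCRIMINANT POLYNOMIAL FOR `2 × 2` MATRICES, NON-VANISHING ALONG DIAGONAL SCALINGS**: over a field `K` of characteristic `0` there is `D ∈ K[X_{ij} : i, j < 2]`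
(`D = (X₀₀ + X₁₁)² − 4(X₀₀X₁₁ − X₀₁X₁₀)`, the discriminant of the characteristic polynomial `X² − tr·X + det`, Mathlib `Matrix.charpoly_fin_two`) with (a) `D(M) ≠ 0 ⇒ charpoly M`
separable, and (b) for every `g` with `det g ≠ 0` some `t ∈ K²` has `D(diag(t)·g) ≠ 0` (witness `t = (1, s)`, `s ∈ {1, 2, 3}`: `D(diag(1,s)·g) = (g₀₀ + s g₁₁)² − 4s·det g`).
[cite: Lang2002, IV §8] -/
theorem exists_mvPolynomial_discr_charpoly_fin_two (K : Type*) [Field K] [CharZero K] :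
    ∃ D : MvPolynomial (Fin 2 × Fin 2) K,
      (∀ M : Matrix (Fin 2) (Fin 2) K, MvPolynomial.eval (fun ij : Fin 2 × Fin 2 => M ij.1 ij.2) D ≠ 0 → M.charpoly.Separable) ∧
      (∀ g : Matrix (Fin 2) (Fin 2) K, g.det ≠ 0 → ∃ t : Fin 2 → K, MvPolynomial.eval (fun ij : Fin 2 × Fin 2 => (Matrix.diagonal t * g) ij.1 ij.2) D ≠ 0) := by
  set x : Fin 2 → Fin 2 → MvPolynomial (Fin 2 × Fin 2) K := fun i j => MvPolynomial.X (i, j) with hx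
  set D : MvPolynomial (Fin 2 × Fin 2) K := (x 0 0 + x 1 1) ^ 2 - 4 * (x 0 0 * x 1 1 - x 0 1 * x 1 0) with hD
  have hev : ∀ M : Matrix (Fin 2) (Fin 2) K, MvPolynomial.eval (fun ij : Fin 2 × Fin 2 => M ij.1 ij.2) D = (M 0 0 + M 1 1) ^ 2 - 4 * (M 0 0 * M 1 1 - M 0 1 * M 1 0) := by
    intro M
    rw [hD, hx]
    simp only [map_sub, map_add, map_mul, map_pow, map_ofNat, MvPolynomial.eval_X]
  refine ⟨D, fun M hM => ?_, fun g hg => ?_⟩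
  · -- (a) `D(M) ≠ 0 ⇒ charpoly M` separable
    rw [hev M] at hM
    have hp : M.charpoly = X ^ 2 + C (-(M 0 0 + M 1 1)) * X + C (M 0 0 * M 1 1 - M 0 1 * M 1 0) := by
      rw [Matrix.charpoly_fin_two, Matrix.trace_fin_two, Matrix.det_fin_two, map_neg]; ring
    rw [hp]
    exact separable_quadratic_of_discriminant_ne_zero _ _ (by rw [neg_sq]; exact hM)
  · -- (b) `t = (1, s)`: `D(diag(1, s)·g) = (g₀₀ + s g₁₁)² − 4 s det g`
    by_contra hall
    push Not at hall
    refine hg (eq_zero_of_quadratic_vanishes (g 0 0) (g 1 1) g.det fun s hs => ?_)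
    have h := hall ![1, s]
    rw [hev] at h
    simp only [Matrix.diagonal_mul] at h
    have e0 : (![1, s] : Fin 2 → K) 0 = 1 := rfl
    have e1 : (![1, s] : Fin 2 → K) 1 = s := rfl
    rw [e0, e1] at h
    rw [Matrix.det_fin_two]
    linear_combination h

end Algebra

/-! ## §2 Model level: the singular set of `U(σ, J)(K)`, `J ∈ M₂(K)` congruent to a diagonal form, is Haar-null -/

section Unitary

variable {K : Type*} [Field K] [TopologicalSpace K] [IsTopologicalRing K] (σ : K →+* K) (hσc : Continuous σ)

variable [ContinuousInv₀ K] [T2Space K] [LocallyCompactSpace K] [SecondCountableTopology K] [MeasurableSpace K] [BorelSpace K] [CharZero K]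

include hσc in
/-- **The diagonal-form case (rank `2`)**: `σ` a continuous involution of the characteristic-`0` local field `K` moving some `a`, `ε_k → 0` non-zero `σ`-fixed, `h ∈ K²`: a CLOSED subset `S`
of `U(σ, diag h)` contains every element with non-separable characteristic polynomial and is NULL for every Haar measure (`S = {D = 0}` for §1's `D`; shear along `diag(u)`, `u ∈ U(1)²`, with
the atomless parameter measure ★ `exists_atomless_measure_normOneTorus`; every fibre is the zero set of a non-zero polynomial in `u`). [cite: HarishChandra1970, Part V Lemma 42]
[cite: Rogawski1990, §12.5 p. 182] -/
theorem exists_closed_null_superset_singular_diagonal_two (hσσ : ∀ x, σ (σ x) = x) {a : K} (ha : σ a ≠ a)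
    {ε : ℕ → K} (hε : Tendsto ε atTop (𝓝 0)) (hε0 : ∀ k, ε k ≠ 0) (hσε : ∀ k, σ (ε k) = ε k) (h : Fin 2 → K)
    [MeasurableSpace ↥(unitaryGroupOfForm σ (Matrix.diagonal h))] [BorelSpace ↥(unitaryGroupOfForm σ (Matrix.diagonal h))] :
    ∃ S : Set ↥(unitaryGroupOfForm σ (Matrix.diagonal h)), IsClosed S ∧
      (∀ u : ↥(unitaryGroupOfForm σ (Matrix.diagonal h)), ¬ ((u : GL (Fin 2) K) : Matrix (Fin 2) (Fin 2) K).charpoly.Separable → u ∈ S) ∧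
      ∀ ν : Measure ↥(unitaryGroupOfForm σ (Matrix.diagonal h)), ν.IsHaarMeasure → ν S = 0 := by
  classical
  obtain ⟨Dp, hDa, hDb⟩ := exists_mvPolynomial_discr_charpoly_fin_two K
  -- topology of `G`
  haveI : SecondCountableTopology (Matrix (Fin 2) (Fin 2) K) := inferInstanceAs (SecondCountableTopology (Fin 2 → Fin 2 → K))
  haveI : SecondCountableTopology (Matrix (Fin 2) (Fin 2) K)ᵐᵒᵖ := MulOpposite.opHomeomorph.symm.secondCountableTopology
  haveI : SecondCountableTopology (GL (Fin 2) K) := Units.isEmbedding_embedProduct.secondCountableTopology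
  haveI : SecondCountableTopology ↥(unitaryGroupOfForm σ (Matrix.diagonal h)) := TopologicalSpace.Subtype.secondCountableTopology _
  haveI : LocallyCompactSpace (Matrix (Fin 2) (Fin 2) K) := inferInstanceAs (LocallyCompactSpace (Fin 2 → Fin 2 → K))
  haveI : LocallyCompactSpace (GL (Fin 2) K) := inferInstance
  haveI : LocallyCompactSpace ↥(unitaryGroupOfForm σ (Matrix.diagonal h)) := (isClosed_unitaryGroupOfForm σ hσc (Matrix.diagonal h)).isClosedEmbedding_subtypeVal.locallyCompactSpace
  -- the closed superset `S = {Φ = 0}`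
  let Φ : ↥(unitaryGroupOfForm σ (Matrix.diagonal h)) → K := fun u => MvPolynomial.eval (fun ij : Fin 2 × Fin 2 => ((u : GL (Fin 2) K) : Matrix (Fin 2) (Fin 2) K) ij.1 ij.2) Dp
  have hΦc : Continuous Φ :=
    (MvPolynomial.continuous_eval Dp).comp (continuous_pi fun ij : Fin 2 × Fin 2 => (Units.continuous_val.comp continuous_subtype_val).matrix_elem ij.1 ij.2)
  have hSm : MeasurableSet (Φ ⁻¹' {0}) := (isClosed_singleton.preimage hΦc).measurableSet
  refine ⟨Φ ⁻¹' {0}, isClosed_singleton.preimage hΦc, fun u hu => ?_, fun ν hν => ?_⟩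
  · by_contra hne
    exact hu (hDa _ hne)
  -- the parameter measure `μ = μ₁ ⊗ μ₁`
  obtain ⟨μ₁, hfin, hne, hatom, hconc⟩ := exists_atomless_measure_normOneTorus σ hσc hσσ ha hε hε0 hσε
  haveI := hfin
  haveI := hatom
  set μ : Measure (Fin 2 → K) := Measure.pi (fun _ : Fin 2 => μ₁) with hμ
  have hμ0 : μ ≠ 0 := by
    intro h0
    have h1 : μ univ = 0 := by rw [h0, Measure.coe_zero, Pi.zero_apply]
    rw [hμ, Measure.pi_univ, Finset.prod_const] at h1
    exact pow_ne_zero _ (Measure.measure_univ_ne_zero.mpr hne) h1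
  -- the diagonal torus `ι`
  set Cset : Set (Fin 2 → K) := {t | ∀ i, t i * σ (t i) = 1} with hC
  have hCcl : IsClosed Cset := by
    have hC' : Cset = ⋂ i, {t : Fin 2 → K | t i * σ (t i) = 1} := by
      ext t
      simp only [hC, mem_setOf_eq, mem_iInter]
    rw [hC']
    exact isClosed_iInter fun i => isClosed_eq ((continuous_apply i).mul (hσc.comp (continuous_apply i))) continuous_const
  have hCne : ∀ t ∈ Cset, ∀ i, t i ≠ 0 := fun t ht i h0 => by
    have h1 := ht i
    rw [h0, zero_mul] at h1
    exact zero_ne_one h1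
  have hdet : ∀ t ∈ Cset, (Matrix.diagonal t).det ≠ 0 := fun t ht => by
    rw [Matrix.det_diagonal]
    exact Finset.prod_ne_zero_iff.mpr fun i _ => hCne t ht i
  have hmem : ∀ t (ht : t ∈ Cset), Matrix.GeneralLinearGroup.mkOfDetNeZero (Matrix.diagonal t) (hdet t ht) ∈ unitaryGroupOfForm σ (Matrix.diagonal h) := fun t ht =>
    mem_unitaryGroupOfForm_diagonal_of_coe_eq_diagonal σ h ht _ rfl
  let ι₀ : ↥Cset → ↥(unitaryGroupOfForm σ (Matrix.diagonal h)) := fun t => ⟨Matrix.GeneralLinearGroup.mkOfDetNeZero (Matrix.diagonal t.1) (hdet t.1 t.2), hmem t.1 t.2⟩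
  have hι₀c : Continuous ι₀ := by
    refine Continuous.subtype_mk ?_ _
    rw [Units.continuous_iff]
    refine ⟨?_, ?_⟩
    · have h1 : (Units.val ∘ fun t : ↥Cset => Matrix.GeneralLinearGroup.mkOfDetNeZero (Matrix.diagonal t.1) (hdet t.1 t.2)) = fun t : ↥Cset => Matrix.diagonal t.1 := rfl
      rw [h1]
      exact continuous_subtype_val.matrix_diagonal
    · have h2 : (fun t : ↥Cset => (((Matrix.GeneralLinearGroup.mkOfDetNeZero (Matrix.diagonal t.1) (hdet t.1 t.2))⁻¹ : GL (Fin 2) K) : Matrix (Fin 2) (Fin 2) K)) =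
          fun t : ↥Cset => Matrix.diagonal fun i => (t.1 i)⁻¹ := by
        funext t
        rw [Matrix.coe_units_inv]
        refine Matrix.inv_eq_left_inv ?_
        show (Matrix.diagonal fun i => (t.1 i)⁻¹) * Matrix.diagonal t.1 = 1
        rw [Matrix.diagonal_mul_diagonal, ← Matrix.diagonal_one]
        congr 1
        funext i
        exact inv_mul_cancel₀ (hCne t.1 t.2 i)
      rw [h2]
      exact (continuous_pi fun i => ((continuous_apply i).comp continuous_subtype_val).inv₀ fun t => hCne t.1 t.2 i).matrix_diagonal
  set ι : (Fin 2 → K) → ↥(unitaryGroupOfForm σ (Matrix.diagonal h)) := fun t => if ht : t ∈ Cset then ι₀ ⟨t, ht⟩ else 1 with hι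
  have hιm : Measurable ι := Measurable.dite hι₀c.measurable measurable_const hCcl.measurableSet
  -- σ-finiteness of the Haar measure `ν`
  haveI : SigmaCompactSpace ↥(unitaryGroupOfForm σ (Matrix.diagonal h)) := sigmaCompactSpace_of_locallyCompact_secondCountable
  haveI : SigmaFinite ν := inferInstance
  refine measure_eq_zero_of_forall_shear_null ν μ hμ0 hιm hSm fun g => ?_
  -- the fibre over `g`: inside `Cᶜ ∪ {t | R_g(t) = 0}` with `R_g ≠ 0`
  set gm : Matrix (Fin 2) (Fin 2) K := ((g : GL (Fin 2) K) : Matrix (Fin 2) (Fin 2) K) with hgm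
  have hgdet : gm.det ≠ 0 := Matrix.GeneralLinearGroup.det_ne_zero _
  obtain ⟨t₀, ht₀⟩ := hDb gm hgdet
  set R : MvPolynomial (Fin 2) K := MvPolynomial.bind₁ (fun ij : Fin 2 × Fin 2 => MvPolynomial.X ij.1 * MvPolynomial.C (gm ij.1 ij.2)) Dp with hR
  have hRev : ∀ t : Fin 2 → K, MvPolynomial.eval t R = MvPolynomial.eval (fun ij : Fin 2 × Fin 2 => (Matrix.diagonal t * gm) ij.1 ij.2) Dp := by
    intro t
    have h1 : MvPolynomial.eval t R = MvPolynomial.eval (fun ij : Fin 2 × Fin 2 => MvPolynomial.eval t (MvPolynomial.X ij.1 * MvPolynomial.C (gm ij.1 ij.2))) Dp := by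
      rw [hR]
      exact MvPolynomial.eval₂Hom_bind₁ _ _ _ _
    have h2 : (fun ij : Fin 2 × Fin 2 => MvPolynomial.eval t (MvPolynomial.X ij.1 * MvPolynomial.C (gm ij.1 ij.2))) = fun ij : Fin 2 × Fin 2 => (Matrix.diagonal t * gm) ij.1 ij.2 := by
      funext ij
      rw [map_mul, MvPolynomial.eval_X, MvPolynomial.eval_C, Matrix.diagonal_mul]
    rw [h1, h2]
  have hR0 : R ≠ 0 := fun h0 => ht₀ (by rw [← hRev, h0, map_zero])
  have hnull : μ {t : Fin 2 → K | MvPolynomial.eval t R = 0} = 0 := by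
    have h1 := pi_zeroLocus_mvPolynomial_eq_zero (K := K) (X := K) (e := id) measurable_id injective_id μ₁ 2 R hR0
    simpa only [id] using h1
  have hCc : μ Csetᶜ = 0 := by
    have hsub : Csetᶜ ⊆ ⋃ i : Fin 2, Function.eval i ⁻¹' {u : K | u * σ u = 1}ᶜ := by
      intro t ht
      simp only [hC, mem_compl_iff, mem_setOf_eq, not_forall] at ht
      obtain ⟨i, hi⟩ := ht
      exact mem_iUnion.2 ⟨i, hi⟩
    exact measure_mono_null hsub (measure_iUnion_null fun i => Measure.pi_eval_preimage_null (fun _ : Fin 2 => μ₁) hconc)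
  refine measure_mono_null (fun t ht => ?_) (measure_union_null hCc hnull)
  by_cases htC : t ∈ Cset
  · refine Or.inr ?_
    simp only [mem_setOf_eq] at ht ⊢
    rw [hRev]
    have hval : (((ι t * g : ↥(unitaryGroupOfForm σ (Matrix.diagonal h))) : GL (Fin 2) K) : Matrix (Fin 2) (Fin 2) K) = Matrix.diagonal t * gm := by
      rw [Subgroup.coe_mul, Units.val_mul, hgm, hι]
      simp only [dif_pos htC]
      rfl
    have ht' : Φ (ι t * g) = 0 := ht
    simpa only [Φ, hval] using ht'
  · exact Or.inl htC

include hσc in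
/-- **A CLOSED, HAAR-NULL SUPERSET OF THE SINGULAR LOCUS OF `U(σ, J)`, `J ∈ M₂(K)` CONGRUENT TO A DIAGONAL FORM** (`formCongr σ T J = ᵗσ(T)·J·T = diag h`): transport of the diagonal case
along `g ↦ T g T⁻¹ : U(σ, diag h) ≃ₜ* U(σ, J)` (★ `unitaryGroupOfFormCongrOfEq`; characteristic polynomials and Haar measures are preserved). [cite: HarishChandra1970, Part V Lemma 42]
[cite: PlatonovRapinchuk1994, §2.3] -/
theorem exists_closed_null_superset_singular_two (hσσ : ∀ x, σ (σ x) = x) {a : K} (ha : σ a ≠ a)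
    {ε : ℕ → K} (hε : Tendsto ε atTop (𝓝 0)) (hε0 : ∀ k, ε k ≠ 0) (hσε : ∀ k, σ (ε k) = ε k)
    {J : Matrix (Fin 2) (Fin 2) K} {T : GL (Fin 2) K} {h : Fin 2 → K} (hT : formCongr σ T J = Matrix.diagonal h)
    [MeasurableSpace ↥(unitaryGroupOfForm σ J)] [BorelSpace ↥(unitaryGroupOfForm σ J)] :
    ∃ S : Set ↥(unitaryGroupOfForm σ J), IsClosed S ∧
      (∀ u : ↥(unitaryGroupOfForm σ J), ¬ ((u : GL (Fin 2) K) : Matrix (Fin 2) (Fin 2) K).charpoly.Separable → u ∈ S) ∧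
      ∀ ν : Measure ↥(unitaryGroupOfForm σ J), ν.IsHaarMeasure → ν S = 0 := by
  letI : MeasurableSpace ↥(unitaryGroupOfForm σ (Matrix.diagonal h)) := borel _
  haveI : BorelSpace ↥(unitaryGroupOfForm σ (Matrix.diagonal h)) := ⟨rfl⟩
  obtain ⟨S₀, hS₀c, hS₀sing, hS₀null⟩ := exists_closed_null_superset_singular_diagonal_two σ hσc hσσ ha hε hε0 hσε h
  set e := unitaryGroupOfFormCongrOfEq σ T J (Matrix.diagonal h) hT with he
  refine ⟨e.symm ⁻¹' S₀, hS₀c.preimage e.symm.continuous, fun u hu => ?_, fun ν hν => ?_⟩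
  · refine hS₀sing (e.symm u) fun hsep => hu ?_
    have hcoe : (((e.symm u : ↥(unitaryGroupOfForm σ (Matrix.diagonal h))) : GL (Fin 2) K) : Matrix (Fin 2) (Fin 2) K) =
        ((T⁻¹ : GL (Fin 2) K) : Matrix (Fin 2) (Fin 2) K) * ((u : GL (Fin 2) K) : Matrix (Fin 2) (Fin 2) K) * (T : Matrix (Fin 2) (Fin 2) K) := by
      rw [he, coe_unitaryGroupOfFormCongrOfEq_symm_apply, Units.val_mul, Units.val_mul]
    rw [hcoe, Matrix.coe_units_inv, Matrix.charpoly_units_conj'] at hsep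
    exact hsep
  · haveI : (ν.map e.symm).IsHaarMeasure := ContinuousMulEquiv.isHaarMeasure_map ν e.symm
    have h1 := hS₀null (ν.map e.symm) inferInstance
    have hm : Measurable (e.symm : ↥(unitaryGroupOfForm σ J) → ↥(unitaryGroupOfForm σ (Matrix.diagonal h))) := e.symm.continuous.measurable
    rwa [Measure.map_apply hm hS₀c.measurableSet] at h1

include hσc in
/-- **THE SINGULAR SET OF `U(σ, J)` IS HAAR-NULL (rank `2`)**: for `J ∈ M₂(K)` congruent over `K` to a diagonal form and every Haar measure `ν` on `U(σ, J)`, the elements whose characteristic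
polynomial is not separable form a `ν`-null set. [cite: HarishChandra1970, Part V Lemma 42] [cite: Rogawski1990, §12.5 p. 182] -/
theorem measure_setOf_not_separable_charpoly_eq_zero_two (hσσ : ∀ x, σ (σ x) = x) {a : K} (ha : σ a ≠ a)
    {ε : ℕ → K} (hε : Tendsto ε atTop (𝓝 0)) (hε0 : ∀ k, ε k ≠ 0) (hσε : ∀ k, σ (ε k) = ε k)
    {J : Matrix (Fin 2) (Fin 2) K} {T : GL (Fin 2) K} {h : Fin 2 → K} (hT : formCongr σ T J = Matrix.diagonal h)
    [MeasurableSpace ↥(unitaryGroupOfForm σ J)] [BorelSpace ↥(unitaryGroupOfForm σ J)] (ν : Measure ↥(unitaryGroupOfForm σ J)) [ν.IsHaarMeasure] :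
    ν {u : ↥(unitaryGroupOfForm σ J) | ¬ ((u : GL (Fin 2) K) : Matrix (Fin 2) (Fin 2) K).charpoly.Separable} = 0 := by
  obtain ⟨S, -, hSsing, hSnull⟩ := exists_closed_null_superset_singular_two σ hσc hσσ ha hε hε0 hσε hT
  exact measure_mono_null (fun u hu => hSsing u hu) (hSnull ν inferInstance)

end Unitary

/-! ## §3 The place-level print on `U(σ_w, Φ₂)(L_w)` for the CM pair (frame `ᵗT Φ₂ T = diag(2, −2)` from ★ (H2)) -/

section Frame

variable (L : Type) [Field L] [NumberField L] [IsCMField L]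
  {v : HeightOneSpectrum (𝓞 ↥(maximalRealSubfield L))} (w : PlacesOver L v) (hw : IsCMField.complexConj L • w.1 = w.1)

/-- **THE NON-REGULAR ELEMENTS OF `U(σ_w, Φ₂)(L_w)` FORM A HAAR-NULL SET** (Harish-Chandra's Lemma 42 at the `N = 2` one-place model of the CM pair, `v` non-split): §2 for `J = Φ₂ = (StdForm.antidiagonal 2).over L_w`,
congruent to `diag(2, −2)` by the rational frame ★ `formCongr_quasiSplitFrameTwo_eq_diagonal`, with the scalar inputs of `L_w` (★ `exists_skew_ne_zero_adicCompletion`, ★ `exists_null_seq_fixed_adicCompletion`); `IsRegularElt` = separable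
characteristic polynomial (★ `isRegularElt_iff`).  The `N = 2` twin of ★ [M2a] `measure_setOf_not_isRegularElt_eq_zero_of_eq_over`. [cite: HarishChandra1970, Part V Lemma 42] [cite: Rogawski1990, §12.5 p. 182] -/
theorem measure_setOf_not_isRegularElt_eq_zero_of_eq_over_two {J : Matrix (Fin 2) (Fin 2) (w.1.adicCompletion L)} (hJ : J = (StdForm.antidiagonal 2).over (w.1.adicCompletion L))
    [MeasurableSpace ↥(unitaryGroupOfForm (galAdicCompletionMap (L := L) (IsCMField.complexConj L) hw) J)]
    [BorelSpace ↥(unitaryGroupOfForm (galAdicCompletionMap (L := L) (IsCMField.complexConj L) hw) J)]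
    (μ : Measure ↥(unitaryGroupOfForm (galAdicCompletionMap (L := L) (IsCMField.complexConj L) hw) J)) [μ.IsHaarMeasure] :
    μ {g | ¬ IsRegularElt ((g : ↥(unitaryGroupOfForm (galAdicCompletionMap (L := L) (IsCMField.complexConj L) hw) J)) : GL (Fin 2) (w.1.adicCompletion L))} = 0 := by
  obtain rfl : J = placeForm (Matrix.of fun i j : Fin 2 => if i.val + j.val + 1 = 2 then (1 : L) else 0) w.1 := hJ.trans (placeForm_antidiagTwo_eq L v w).symm
  letI : MeasurableSpace (w.1.adicCompletion L) := borel _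
  haveI : BorelSpace (w.1.adicCompletion L) := ⟨rfl⟩
  haveI : SecondCountableTopology (w.1.adicCompletion L) := secondCountableTopology_adicCompletion L w.1
  haveI : CharZero (w.1.adicCompletion L) := charZero_of_injective_algebraMap (algebraMap L (w.1.adicCompletion L)).injective
  have hσc : Continuous (galAdicCompletionMap (L := L) (IsCMField.complexConj L) hw) := continuous_galAdicCompletionMap L (IsCMField.complexConj L) hw
  have hσσ : ∀ x, galAdicCompletionMap (L := L) (IsCMField.complexConj L) hw (galAdicCompletionMap (L := L) (IsCMField.complexConj L) hw x) = x :=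
    galAdicCompletionMap_galAdicCompletionMap_of_smul_eq (IsCMField.complexConj L) w (IsCMField.complexConj_ne_one L) hw
  obtain ⟨δ, hσδ, hδ⟩ := exists_skew_ne_zero_adicCompletion (IsCMField.complexConj L) (IsCMField.complexConj_ne_one L) w hw
  have ha : galAdicCompletionMap (L := L) (IsCMField.complexConj L) hw δ ≠ δ := by
    rw [hσδ]
    intro hneg
    apply hδ
    have h2 : (2 : w.1.adicCompletion L) * δ = 0 := by linear_combination -hneg
    exact (mul_eq_zero.mp h2).resolve_left two_ne_zero
  obtain ⟨ε, hε, hε0, hσε⟩ := exists_null_seq_fixed_adicCompletion (IsCMField.complexConj L) (IsCMField.complexConj_ne_one L) w hw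
  obtain ⟨S, -, hSsing, hSnull⟩ := exists_closed_null_superset_singular_two (galAdicCompletionMap (L := L) (IsCMField.complexConj L) hw) hσc hσσ ha hε hε0 hσε
    (formCongr_quasiSplitFrameTwo_eq_diagonal L w.1 hw)
  exact measure_mono_null (fun g hg => hSsing g hg) (hSnull μ inferInstance)

/-- **ALMOST EVERY ELEMENT OF `U(σ_w, Φ₂)(L_w)` IS REGULAR SEMISIMPLE** (the `∀ᵐ` reading) — the «singular `g` are null» input of the `N = 2` supercuspidal-slice assembly (K2E3-p31's
`K2E3SupercuspModelFrameAtPlaceTwo` §5). [cite: HarishChandra1970, Part V Lemma 42] [cite: Rogawski1990, §12.5 p. 182] -/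
theorem ae_isRegularElt_of_eq_over_two {J : Matrix (Fin 2) (Fin 2) (w.1.adicCompletion L)} (hJ : J = (StdForm.antidiagonal 2).over (w.1.adicCompletion L))
    [MeasurableSpace ↥(unitaryGroupOfForm (galAdicCompletionMap (L := L) (IsCMField.complexConj L) hw) J)]
    [BorelSpace ↥(unitaryGroupOfForm (galAdicCompletionMap (L := L) (IsCMField.complexConj L) hw) J)]
    (μ : Measure ↥(unitaryGroupOfForm (galAdicCompletionMap (L := L) (IsCMField.complexConj L) hw) J)) [μ.IsHaarMeasure] :
    ∀ᵐ g ∂μ, IsRegularElt ((g : ↥(unitaryGroupOfForm (galAdicCompletionMap (L := L) (IsCMField.complexConj L) hw) J)) : GL (Fin 2) (w.1.adicCompletion L)) := by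
  rw [ae_iff]
  exact measure_setOf_not_isRegularElt_eq_zero_of_eq_over_two L w hw hJ μ

end Frame

end Summit.HodgeConjecture.HodgeConjecture.Cruxes.H413.K2E3UnitarySingularLocusNullTwo

end
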